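/-
Copyright (c) 2026 the pub-hodgecm-mathlib formalisation cell (harness21).  Prover seat hodgecm-mathlib-F0P3-p02 (g16), 2026-09-01.  Road «S3-ram» seeding wave (LEAD F0P3a-plan (g12) T11-41∕T11-54∕T11-57;
owner F0P3a-p06 (g15)), row «(L)-ram» file L5-C1: the strata of a `v`-level-one piece through a level frame, SPLIT form (rank-one interior stratum returned structurally), tame-RAMIFIED place.
-/
import Literature.NumberTheory.Automorphic.TorusTwoDeepLevelTwoStrataRamified       -- ★ FILE L3 (this seat, p846961): `apply_symm_torus_mul_levelTwo_values_of_ramified` and its §2∕§4 machinery; ⊇ ★ FILE L2, ★ FILE L1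
import Literature.NumberTheory.Automorphic.HeisenbergLevelTwoStrataSplitRamified     -- ★ FILE L5-A (this seat, p847006): `red_inv_mul_heisElt_entry_eq` (`(n_w)₀₂ = z_w`)
import HarnessLib

/-!
# The strata of a `v`-level-one `K`-class piece through a level frame, SPLIT FORM, at a TAME-RAMIFIED place
(Rogawski (1990) §4.9 pp. 54–56, §12.2 p. 173; Kottwitz (1986) §3; Jacobowitz (1962) §5)

Topic `NumberTheory/Automorphic`; namespace `Literature.NumberTheory.Automorphic.UnitaryGroup`.  KERNEL mathematics only: theorems, no definition, no named fact, no instance,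
no notation, no `sorry`.  Cell `pub/hodgecm-mathlib`, crux H413 = `stmt-HodgeConjecture-24833`; road «S3-ram» seeding wave (LEAD F0P3a-plan (g12); owner F0P3a-p06 (g15)), row **«(L)-ram»,
FILE L5-C1** (seat F0P3-p02 (g16)); sequel of ★ FILE L3 `TorusTwoDeepLevelTwoStrataRamified` (p846961).  CONSUMER: FILE L5-C2 `Rogawski1990/LevelOnePieceAverageSplitRamified` — the
`hN` socket of ★ p846921 for a piece obeying the TWO-LAYER (U)-ram HEAD ★ `exists_twoLayerStrataValues_of_levelOne_ramified_of_not_isSquare` (F0P2-p01 (g15)), whose rank-one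
interior row carries TWO values (residue square class of the `J̄′`-form).  HONEST LABEL: HC_CM is proved only modulo the 2 remaining named inputs (hLiu418 24832, h413 24833) until
rung 0 closes; «S3-ram» is Literature seeding; this file discharges no named fact.

THE MATHEMATICS.  `v` non-split, TAMELY RAMIFIED (`e(w|v) ≠ 1`, `|2|_w = 1`), `ϖ ∈ L_w` with `|ϖ| = exp(−1)`, `N(x) := red(ϖ⁻¹(x_w − 1))` for `x_w ≡ 1 (ϖ)`.
* §1 **the rank-one interior points of `N ∩ K₃` in the chart**: `rank N(n) = 1` forces `|x_w| ≤ exp(−2)`, `|y_w| = exp(−1)` and **`N(n) = β • E₀₂`, `β = red(ϖ⁻¹(n_w)₀₂) ≠ 0`**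
  (`redMat_smul_sub_one_eq_smul_of_rank_eq_one`) — `β` is the residue whose square class splits the stratum (★ FILE L5-A∕L5-B).
* §2 **the strata of `n ↦ g(ψ⁻¹(t n))`, split form** (`apply_symm_torus_mul_levelTwo_values_split_of_ramified`): as ★ FILE L3 §4 (`ψ` a level frame with integral matrix reading
  `(ψ x)_w = T x_w T⁻¹`, `t ∈ T` regular and 2-deep in `w`, `g` supported in `K′` with the boundary pin `hc` and the rank-`0`∕rank-`2` interior pins `hc′`), except that on the
  rank-one interior stratum NO value is asserted: the theorem returns `k = ψ⁻¹(t n) ∈ K′`, `k_w ≡ 1 (ϖ)`, `N(k)³ = 0`, `rank N(k) = 1` and **`N(k) = red(T⁻¹)·N(n)·red(T)`**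
  (★ FILE L3's `redMat_inv_smul_mul_sub_one_of_two_deep` + `redMat_coe_inv_mul_mul_coe`), so that FILE L5-C2 can evaluate the `J̄′`-form label of the (U)-ram head on it.

## References
* [Rogawski1990] J. D. Rogawski, *Automorphic Representations of Unitary Groups in Three Variables*, Ann. of Math. Stud. 123 (1990), §1.10 p. 9; §4.9 pp. 54–56; §12.2 p. 173.
* [Kottwitz1986] R. E. Kottwitz, *Base change for unit elements of Hecke algebras*, Compositio Math. 60 (1986), §3 (congruence filtration).
* [Jacobowitz1962] R. Jacobowitz, *Hermitian forms over local fields*, Amer. J. Math. 84 (1962), §5 (ramified case).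
-/

set_option autoImplicit false

noncomputable section

open MeasureTheory Measure Set Filter Topology NumberField IsDedekindDomain Matrix ValuativeRel
open scoped ENNReal NNReal Matrix MatrixGroups ValuativeRel WithZero

namespace Literature.NumberTheory.Automorphic.UnitaryGroup

open Literature.NumberTheory.Rogawski1990 (IsRegularElt)
open Literature.NumberTheory.Automorphic Literature.NumberTheory.Automorphic.IntegralReduction Literature.NumberTheory.GaloisRepresentations

variable (L : Type) [Field L] [NumberField L] [IsCMField L] {v : HeightOneSpectrum (𝓞 ↥(maximalRealSubfield L))}
  (w : PlacesOver L v) (hw : IsCMField.complexConj L • w.1 = w.1)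

/-! ## §1 The rank-one interior points of `N ∩ K₃` in the chart: `N(n) = β • E₀₂`, `β = red(ϖ⁻¹(n_w)₀₂) ≠ 0` -/

set_option maxHeartbeats 1600000 in
-- instance-term unification on the CM local carriers (as in ★ FILE L3 §2)
include hw in
/-- **THE RANK-ONE INTERIOR POINTS OF `N ∩ K₃` IN THE CHART** (generic `ϖ`, `|ϖ| = exp(−1)`): if `red(n_w) = 1` and `rank red(ϖ⁻¹(n_w − 1)) = 1` then `|x_w| ≤ exp(−2)`,
`|y_w| = exp(−1)` and **`red(ϖ⁻¹(n_w − 1)) = β • E₀₂` with `β = red(ϖ⁻¹·(n_w)₀₂) ≠ 0`** (★ FILE L1 `smul_map_heisElt_sub_one`, ★ FILE L5-A `red_inv_mul_heisElt_entry_eq`).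
[cite: Rogawski1990, §1.10 p. 9; §4.9 p. 54] [cite: Kottwitz1986, §3] [cite: Jacobowitz1962, §5] -/
theorem redMat_smul_sub_one_eq_smul_of_rank_eq_one {ϖ : w.1.adicCompletion L} (hϖ : Valued.v ϖ = WithZero.exp (-1 : ℤ)) (h2w : Valued.v (2 : w.1.adicCompletion L) = 1)
    (n : ↥(unipotentU (conjLocal L (IsCMField.complexConj L) v) (cmLocalForm L 3 v))) (hn : (n : ↥(unitaryGroupOfForm (conjLocal L (IsCMField.complexConj L) v) (cmLocalForm L 3 v))) ∈ cmLocalIntegralLevel L 3 (Matrix.of fun i j : Fin 3 => if i.val + j.val + 1 = 3 then (1 : L) else 0) v)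
    (h0 : (redMat (((n : ↥(unitaryGroupOfForm (conjLocal L (IsCMField.complexConj L) v) (cmLocalForm L 3 v))) : GL (Fin 3) (LocalRing L v)).val.map (Pi.evalRingHom (fun w' : PlacesOver L v => w'.1.adicCompletion L) w)) - 1).rank = 0) (h1 : (redMat (ϖ⁻¹ • ((((n : ↥(unitaryGroupOfForm (conjLocal L (IsCMField.complexConj L) v) (cmLocalForm L 3 v))) : GL (Fin 3) (LocalRing L v)).val.map (Pi.evalRingHom (fun w' : PlacesOver L v => w'.1.adicCompletion L) w)) - 1))).rank = 1) :
    redMat (ϖ⁻¹ • ((((n : ↥(unitaryGroupOfForm (conjLocal L (IsCMField.complexConj L) v) (cmLocalForm L 3 v))) : GL (Fin 3) (LocalRing L v)).val.map (Pi.evalRingHom (fun w' : PlacesOver L v => w'.1.adicCompletion L) w)) - 1)) = red (ϖ⁻¹ * (((n : ↥(unitaryGroupOfForm (conjLocal L (IsCMField.complexConj L) v) (cmLocalForm L 3 v))) : GL (Fin 3) (LocalRing L v)).val.map (Pi.evalRingHom (fun w' : PlacesOver L v => w'.1.adicCompletion L) w)) 0 2) • (!![0, 0, 1; 0, 0, 0;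 0, 0, 0] : Matrix (Fin 3) (Fin 3) 𝓀[w.1.adicCompletion L]) ∧
      red (ϖ⁻¹ * (((n : ↥(unitaryGroupOfForm (conjLocal L (IsCMField.complexConj L) v) (cmLocalForm L 3 v))) : GL (Fin 3) (LocalRing L v)).val.map (Pi.evalRingHom (fun w' : PlacesOver L v => w'.1.adicCompletion L) w)) 0 2) ≠ 0 := by
  letI : Invertible (2 : LocalRing L v) := (isUnit_two_localRing L v).invertible
  obtain ⟨he1, he2, he21⟩ := exp_neg_lt_one
  have hn' := HeisRing.heisElt_heisX_heisY (conjLocal L (IsCMField.complexConj L) v) (conjLocal_conjLocal_cm L v) (cmLocalForm_eq_over L 3 v) n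
  rw [← hn'] at hn h0 h1 ⊢
  obtain ⟨hx, hy⟩ := (heisElt_mem_cmLocalIntegralLevel_iff L v w hw h2w _ _).1 hn
  obtain ⟨hx', hy'⟩ := (rank_redMat_map_heisElt_sub_one_eq_zero_iff L v w hw h2w hx hy).1 h0
  -- rank one forces `|x_w| ≤ exp(−2)` and `|y_w| = exp(−1)`
  have hx2 : Valued.v ((HeisRing.heisX (conjLocal L (IsCMField.complexConj L) v) n) w) ≤ WithZero.exp (-2 : ℤ) := by
    rcases valued_levelTwo_cases L v w hx' with h | h
    · rw [rank_redMat_smul_map_heisElt_sub_one_eq_two L v w hw hϖ h _] at h1; exact absurd h1 (by decide)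
    · exact h
  have hy1 : Valued.v (((HeisRing.heisY (conjLocal L (IsCMField.complexConj L) v) (conjLocal_conjLocal_cm L v) (cmLocalForm_eq_over L 3 v) n : HeisRing.skewPart (conjLocal L (IsCMField.complexConj L) v)) : LocalRing L v) w) = WithZero.exp (-1 : ℤ) := by
    rcases valued_levelTwo_cases L v w hy' with h | h
    · exact h
    · rw [rank_redMat_smul_map_heisElt_sub_one_eq_zero L v w hw hϖ h2w hx2 h] at h1; exact absurd h1 (by decide)
  obtain ⟨h02, -⟩ := red_inv_mul_heisElt_entry_eq L v w hw hϖ h2w hx2 hy1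
  obtain ⟨-, -, h3⟩ := valued_inv_mul_trichotomy_of_valued_eq L v w hϖ ((HeisRing.heisX (conjLocal L (IsCMField.complexConj L) v) n) w)
  obtain ⟨-, -, h3σ⟩ := valued_inv_mul_trichotomy_of_valued_eq L v w hϖ (-((conjLocal L (IsCMField.complexConj L) v (HeisRing.heisX (conjLocal L (IsCMField.complexConj L) v) n)) w))
  have hσ : Valued.v (-((conjLocal L (IsCMField.complexConj L) v (HeisRing.heisX (conjLocal L (IsCMField.complexConj L) v) n)) w)) ≤ WithZero.exp (-2 : ℤ) := by
    rw [Valuation.map_neg, valued_conjLocal_apply_of_smul_eq L v w hw]; exact hx2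
  have hx1 : Valued.v ((HeisRing.heisX (conjLocal L (IsCMField.complexConj L) v) n) w) < 1 := lt_of_le_of_lt hx2 he2
  have hz := (valued_heisZ_apply_levelTwo L v w hw h2w hx1 (((HeisRing.heisY (conjLocal L (IsCMField.complexConj L) v) (conjLocal_conjLocal_cm L v) (cmLocalForm_eq_over L 3 v) n : HeisRing.skewPart (conjLocal L (IsCMField.complexConj L) v)) : LocalRing L v))).1 hy1
  have hz1 : Valued.v ((HeisRing.heisZ (conjLocal L (IsCMField.complexConj L) v) (HeisRing.heisX (conjLocal L (IsCMField.complexConj L) v) n)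
      (((HeisRing.heisY (conjLocal L (IsCMField.complexConj L) v) (conjLocal_conjLocal_cm L v) (cmLocalForm_eq_over L 3 v) n : HeisRing.skewPart (conjLocal L (IsCMField.complexConj L) v)) : LocalRing L v))) w) < 1 := by
    rw [valued_lt_one_iff_le_exp_neg_one L v w, hz]
  rw [h02]
  refine ⟨?_, (red_inv_mul_ne_zero_iff_of_valued_eq L v w hϖ hz1).2 hz⟩
  rw [smul_map_heisElt_sub_one L v w, redMat_strictUpper, red_eq_zero_of_v_lt_one L v w (h3.2 hx2), red_eq_zero_of_v_lt_one L v w (h3σ.2 hσ)]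
  ext i j
  fin_cases i <;> fin_cases j <;> simp [Matrix.smul_apply]

/-! ## §2 The strata of `n ↦ g(ψ⁻¹(t n))` at a 2-deep regular `t`, SPLIT form (rank-one interior stratum returned structurally) -/

set_option maxHeartbeats 1600000 in
-- instance-term unification on the CM local carriers (as in ★ FILE D ∕ ★ p846544)
include hw in
/-- **THE STRATA OF A `v`-LEVEL-ONE PIECE THROUGH THE FRAME, SPLIT FORM, TAME-RAMIFIED PLACE** (as ★ `apply_symm_torus_mul_levelTwo_values_of_ramified`, but the
rank-one interior stratum is returned STRUCTURALLY: `k = ψ⁻¹(t n) ∈ K′`, `k_w ≡ 1 (ϖ)`, `N(k) := red(ϖ⁻¹(k_w − 1))` cube-nilpotent of rank one, and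
`N(k) = red(T⁻¹)·red(ϖ⁻¹(n_w − 1))·red(T)` — so any conjugation-covariant label of `N(k)` can be read off the chart).  `ψ` the level-preserving frame reading `(ψ g)_w = T g_w T⁻¹` (`T ∈ GL₃(𝒪_w)`),
`t = diag(d) ∈ T` REGULAR (`d₀⁻¹d₁ − 1`, `d₀⁻¹d₂ − 1` units) and 2-DEEP in `w` (`|d_{i,w} − 1|_w ≤ exp(−2)`, i.e. `t_w ≡ 1 (ϖ_v)`), `ϖ ∈ L_w` with `|ϖ| = exp(−1)`,
`g` supported in `K′` with the value pins `hc` (boundary: value `c₂` on residually regular unipotents of `K′` lying in a `v`-level-1 class — token `(ι_v ϖ_v)^1`) and `hc′`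
(interior: values `c′ s` on `x_w ≡ 1 (ϖ)` with `red(ϖ⁻¹(x_w − 1))` cube-nilpotent of rank `s`).  Then `n ↦ g(ψ⁻¹(t n))` vanishes off `K₃` and takes the values `c₂, c′ 2, c′ 1, c′ 0`
on the boundary-regular stratum and the three interior strata of `N ∩ K₃` (the five hypotheses of ★ `integral_eq_of_levelTwo_strata_of_ramified`; the rank-1 boundary
stratum is empty at a ramified place and gets no clause).  Ramified twin of ★ `apply_symm_torus_mul_levelTwo_values`.
[cite: Rogawski1990, §4.9 pp. 54–56; §12.2 p. 173] [cite: Kottwitz1986, §3] [cite: Jacobowitz1962, §5] -/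
theorem apply_symm_torus_mul_levelTwo_values_split_of_ramified (H' : Matrix (Fin 3) (Fin 3) L)
    (ψ : (cmDatum L 3 H').Local v ≃ₜ* ↥(unitaryGroupOfForm (conjLocal L (IsCMField.complexConj L) v) (cmLocalForm L 3 v)))
    (hψK : ∀ g : (cmDatum L 3 H').Local v, ψ g ∈ cmLocalIntegralLevel L 3 (Matrix.of fun i j : Fin 3 => if i.val + j.val + 1 = 3 then (1 : L) else 0) v ↔
      g ∈ cmLocalIntegralLevel L 3 H' v)
    (T : GL (Fin 3) (w.1.adicCompletion L)) (hT : T ∈ glInt 3 (w.1.adicCompletion L))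
    (hψT : ∀ g : (cmDatum L 3 H').Local v, localGLPiEquiv L 3 v
        (((ψ g : ↥(unitaryGroupOfForm (conjLocal L (IsCMField.complexConj L) v) (cmLocalForm L 3 v)))) : GL (Fin 3) (LocalRing L v)) w =
      T * localGLPiEquiv L 3 v (g.val : GL (Fin 3) (LocalRing L v)) w * T⁻¹)
    (he : v.asIdeal.ramificationIdx' w.1.asIdeal ≠ 1) {ϖ : w.1.adicCompletion L} (hϖ : Valued.v ϖ = WithZero.exp (-1 : ℤ)) (h2w : Valued.v (2 : w.1.adicCompletion L) = 1)
    (t : ↥(torusU (conjLocal L (IsCMField.complexConj L) v) (cmLocalForm L 3 v))) {d : Fin 3 → (LocalRing L v)ˣ}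
    (hd : glDiagonal 3 (LocalRing L v) d = ((t : ↥(unitaryGroupOfForm (conjLocal L (IsCMField.complexConj L) v) (cmLocalForm L 3 v))) : GL (Fin 3) (LocalRing L v)))
    (ha' : IsUnit ((((d 0)⁻¹ * d 1 : (LocalRing L v)ˣ) : LocalRing L v) - 1)) (hb' : IsUnit ((((d 0)⁻¹ * d 2 : (LocalRing L v)ˣ) : LocalRing L v) - 1))
    (ht2 : ∀ i : Fin 3, Valued.v ((((d i : (LocalRing L v)ˣ) : LocalRing L v) w) - 1) ≤ WithZero.exp (-2 : ℤ))
    (g : (cmDatum L 3 H').Local v → ℂ) (hgK : tsupport g ⊆ (cmLocalIntegralLevel L 3 H' v : Set ((cmDatum L 3 H').Local v)))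
    (c₂ : ℂ) (c' : ℕ → ℂ) (hc : ∀ x : ((cmDatum L 3 H').Local v), (x ∈ cmLocalIntegralLevel L 3 H' v ∧ (redMat (((x).val : GL (Fin 3) (UnitaryGroup.LocalRing L v)).val.map (Pi.evalRingHom (fun w' : PlacesOver L v => w'.1.adicCompletion L) w)) - 1) ^ 3 = 0 ∧ (redMat (((x).val : GL (Fin 3) (UnitaryGroup.LocalRing L v)).val.map (Pi.evalRingHom (fun w' : PlacesOver L v => w'.1.adicCompletion L) w)) - 1).rank = 2 ∧
        ∃ y : ((cmDatum L 3 H').Local v), (∀ a b, Valued.v (((toPlace v w (HeckeCharacter.uniformizer ↥(maximalRealSubfield L) v : v.adicCompletion ↥(maximalRealSubfield L))) ^ 1)⁻¹ *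
        ((((localNonsplitEquiv (IsCMField.complexConj L) H' (IsCMField.complexConj_ne_one L) w hw (y * x * y⁻¹) :
            ↥(unitaryGroupOfForm (galAdicCompletionMap (L := L) (IsCMField.complexConj L) hw) (placeForm H' w.1))) : GL (Fin 3) (w.1.adicCompletion L)) :
              Matrix (Fin 3) (Fin 3) (w.1.adicCompletion L)) a b - (1 : Matrix (Fin 3) (Fin 3) (w.1.adicCompletion L)) a b)) ≤ 1)) → g x = c₂)
    (hc' : ((∀ x : ((cmDatum L 3 H').Local v), (x ∈ cmLocalIntegralLevel L 3 H' v ∧ (∀ a b, Valued.v (ϖ⁻¹ * ((((x).val : GL (Fin 3) (UnitaryGroup.LocalRing L v)).val.map (Pi.evalRingHom (fun w' : PlacesOver L v => w'.1.adicCompletion L) w)) a b - (1 : Matrix (Fin 3) (Fin 3) (w.1.adicCompletion L)) a b)) ≤ 1) ∧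
        (redMat (ϖ⁻¹ • ((((x).val : GL (Fin 3) (UnitaryGroup.LocalRing L v)).val.map (Pi.evalRingHom (fun w' : PlacesOver L v => w'.1.adicCompletion L) w)) - 1))) ^ 3 = 0 ∧ (redMat (ϖ⁻¹ • ((((x).val : GL (Fin 3) (UnitaryGroup.LocalRing L v)).val.map (Pi.evalRingHom (fun w' : PlacesOver L v => w'.1.adicCompletion L) w)) - 1))).rank = 0) → g x = c' 0) ∧
      (∀ x : ((cmDatum L 3 H').Local v), (x ∈ cmLocalIntegralLevel L 3 H' v ∧ (∀ a b, Valued.v (ϖ⁻¹ * ((((x).val : GL (Fin 3) (UnitaryGroup.LocalRing L v)).val.map (Pi.evalRingHom (fun w' : PlacesOver L v => w'.1.adicCompletion L) w)) a b - (1 : Matrix (Fin 3) (Fin 3) (w.1.adicCompletion L)) a b)) ≤ 1) ∧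
        (redMat (ϖ⁻¹ • ((((x).val : GL (Fin 3) (UnitaryGroup.LocalRing L v)).val.map (Pi.evalRingHom (fun w' : PlacesOver L v => w'.1.adicCompletion L) w)) - 1))) ^ 3 = 0 ∧ (redMat (ϖ⁻¹ • ((((x).val : GL (Fin 3) (UnitaryGroup.LocalRing L v)).val.map (Pi.evalRingHom (fun w' : PlacesOver L v => w'.1.adicCompletion L) w)) - 1))).rank = 2) → g x = c' 2))) :
    (∀ n : ↥(unipotentU (conjLocal L (IsCMField.complexConj L) v) (cmLocalForm L 3 v)), (n : ↥(unitaryGroupOfForm (conjLocal L (IsCMField.complexConj L) v) (cmLocalForm L 3 v))) ∈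
          cmLocalIntegralLevel L 3 (Matrix.of fun i j : Fin 3 => if i.val + j.val + 1 = 3 then (1 : L) else 0) v →
        (redMat (((n : ↥(unitaryGroupOfForm (conjLocal L (IsCMField.complexConj L) v) (cmLocalForm L 3 v))) : GL (Fin 3) (LocalRing L v)).val.map (Pi.evalRingHom (fun w' : PlacesOver L v => w'.1.adicCompletion L) w)) - 1).rank = 2 →
        g (ψ.symm ((t : ↥(unitaryGroupOfForm (conjLocal L (IsCMField.complexConj L) v) (cmLocalForm L 3 v))) *
        (n : ↥(unitaryGroupOfForm (conjLocal L (IsCMField.complexConj L) v) (cmLocalForm L 3 v))))) = c₂) ∧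
    (∀ n : ↥(unipotentU (conjLocal L (IsCMField.complexConj L) v) (cmLocalForm L 3 v)), (n : ↥(unitaryGroupOfForm (conjLocal L (IsCMField.complexConj L) v) (cmLocalForm L 3 v))) ∈
          cmLocalIntegralLevel L 3 (Matrix.of fun i j : Fin 3 => if i.val + j.val + 1 = 3 then (1 : L) else 0) v →
        (redMat (((n : ↥(unitaryGroupOfForm (conjLocal L (IsCMField.complexConj L) v) (cmLocalForm L 3 v))) : GL (Fin 3) (LocalRing L v)).val.map (Pi.evalRingHom (fun w' : PlacesOver L v => w'.1.adicCompletion L) w)) - 1).rank = 0 →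
        (redMat (ϖ⁻¹ •
          ((((n : ↥(unitaryGroupOfForm (conjLocal L (IsCMField.complexConj L) v) (cmLocalForm L 3 v))) : GL (Fin 3) (LocalRing L v)).val.map (Pi.evalRingHom (fun w' : PlacesOver L v => w'.1.adicCompletion L) w)) - 1))).rank = 2 →
        g (ψ.symm ((t : ↥(unitaryGroupOfForm (conjLocal L (IsCMField.complexConj L) v) (cmLocalForm L 3 v))) *
        (n : ↥(unitaryGroupOfForm (conjLocal L (IsCMField.complexConj L) v) (cmLocalForm L 3 v))))) = c' 2) ∧
    (∀ n : ↥(unipotentU (conjLocal L (IsCMField.complexConj L) v) (cmLocalForm L 3 v)), (n : ↥(unitaryGroupOfForm (conjLocal L (IsCMField.complexConj L) v) (cmLocalForm L 3 v))) ∈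
          cmLocalIntegralLevel L 3 (Matrix.of fun i j : Fin 3 => if i.val + j.val + 1 = 3 then (1 : L) else 0) v →
        (redMat (((n : ↥(unitaryGroupOfForm (conjLocal L (IsCMField.complexConj L) v) (cmLocalForm L 3 v))) : GL (Fin 3) (LocalRing L v)).val.map (Pi.evalRingHom (fun w' : PlacesOver L v => w'.1.adicCompletion L) w)) - 1).rank = 0 →
        (redMat (ϖ⁻¹ •
          ((((n : ↥(unitaryGroupOfForm (conjLocal L (IsCMField.complexConj L) v) (cmLocalForm L 3 v))) : GL (Fin 3) (LocalRing L v)).val.map (Pi.evalRingHom (fun w' : PlacesOver L v => w'.1.adicCompletion L) w)) - 1))).rank = 1 →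
        ψ.symm ((t : ↥(unitaryGroupOfForm (conjLocal L (IsCMField.complexConj L) v) (cmLocalForm L 3 v))) * (n : ↥(unitaryGroupOfForm (conjLocal L (IsCMField.complexConj L) v) (cmLocalForm L 3 v)))) ∈ cmLocalIntegralLevel L 3 H' v ∧
        (∀ a b, Valued.v (ϖ⁻¹ * ((((ψ.symm ((t : ↥(unitaryGroupOfForm (conjLocal L (IsCMField.complexConj L) v) (cmLocalForm L 3 v))) * (n : ↥(unitaryGroupOfForm (conjLocal L (IsCMField.complexConj L) v) (cmLocalForm L 3 v))))).val : GL (Fin 3) (UnitaryGroup.LocalRing L v)).val.map (Pi.evalRingHom (fun w' : PlacesOver L v => w'.1.adicCompletion L) w)) a b - (1 : Matrix (Fin 3) (Fin 3) (w.1.adicCompletion L)) a b)) ≤ 1) ∧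
        (redMat (ϖ⁻¹ • ((((ψ.symm ((t : ↥(unitaryGroupOfForm (conjLocal L (IsCMField.complexConj L) v) (cmLocalForm L 3 v))) * (n : ↥(unitaryGroupOfForm (conjLocal L (IsCMField.complexConj L) v) (cmLocalForm L 3 v))))).val : GL (Fin 3) (UnitaryGroup.LocalRing L v)).val.map (Pi.evalRingHom (fun w' : PlacesOver L v => w'.1.adicCompletion L) w)) - 1))) ^ 3 = 0 ∧ (redMat (ϖ⁻¹ • ((((ψ.symm ((t : ↥(unitaryGroupOfForm (conjLocal L (IsCMField.complexConj L) v) (cmLocalForm L 3 v))) * (n : ↥(unitaryGroupOfForm (conjLocal L (IsCMField.complexConj L) v) (cmLocalForm L 3 v))))).val : GL (Fin 3) (UnitaryGroup.LocalRing L v)).val.map (Pi.evalRingHom (fun w' : PlacesOver L v => w'.1.adicCompletion L) w)) - 1))).rank = 1 ∧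
        redMat (ϖ⁻¹ • ((((ψ.symm ((t : ↥(unitaryGroupOfForm (conjLocal L (IsCMField.complexConj L) v) (cmLocalForm L 3 v))) * (n : ↥(unitaryGroupOfForm (conjLocal L (IsCMField.complexConj L) v) (cmLocalForm L 3 v))))).val : GL (Fin 3) (UnitaryGroup.LocalRing L v)).val.map (Pi.evalRingHom (fun w' : PlacesOver L v => w'.1.adicCompletion L) w)) - 1)) = redMat ((T⁻¹ : GL (Fin 3) (w.1.adicCompletion L)) : Matrix (Fin 3) (Fin 3) (w.1.adicCompletion L)) * redMat (ϖ⁻¹ • ((((n : ↥(unitaryGroupOfForm (conjLocal L (IsCMField.complexConj L) v) (cmLocalForm L 3 v))) : GL (Fin 3) (LocalRing L v)).val.map (Pi.evalRingHom (fun w' : PlacesOver L v => w'.1.adicCompletion L) w)) - 1)) * redMat (T : Matrix (Fin 3) (Fin 3) (w.1.adicCompletion L))) ∧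
    (∀ n : ↥(unipotentU (conjLocal L (IsCMField.complexConj L) v) (cmLocalForm L 3 v)), (n : ↥(unitaryGroupOfForm (conjLocal L (IsCMField.complexConj L) v) (cmLocalForm L 3 v))) ∈
          cmLocalIntegralLevel L 3 (Matrix.of fun i j : Fin 3 => if i.val + j.val + 1 = 3 then (1 : L) else 0) v →
        (redMat (((n : ↥(unitaryGroupOfForm (conjLocal L (IsCMField.complexConj L) v) (cmLocalForm L 3 v))) : GL (Fin 3) (LocalRing L v)).val.map (Pi.evalRingHom (fun w' : PlacesOver L v => w'.1.adicCompletion L) w)) - 1).rank = 0 →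
        (redMat (ϖ⁻¹ •
          ((((n : ↥(unitaryGroupOfForm (conjLocal L (IsCMField.complexConj L) v) (cmLocalForm L 3 v))) : GL (Fin 3) (LocalRing L v)).val.map (Pi.evalRingHom (fun w' : PlacesOver L v => w'.1.adicCompletion L) w)) - 1))).rank = 0 →
        g (ψ.symm ((t : ↥(unitaryGroupOfForm (conjLocal L (IsCMField.complexConj L) v) (cmLocalForm L 3 v))) *
        (n : ↥(unitaryGroupOfForm (conjLocal L (IsCMField.complexConj L) v) (cmLocalForm L 3 v))))) = c' 0) ∧
    (∀ n : ↥(unipotentU (conjLocal L (IsCMField.complexConj L) v) (cmLocalForm L 3 v)), (n : ↥(unitaryGroupOfForm (conjLocal L (IsCMField.complexConj L) v) (cmLocalForm L 3 v))) ∉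
          cmLocalIntegralLevel L 3 (Matrix.of fun i j : Fin 3 => if i.val + j.val + 1 = 3 then (1 : L) else 0) v → g (ψ.symm ((t : ↥(unitaryGroupOfForm (conjLocal L (IsCMField.complexConj L) v) (cmLocalForm L 3 v))) *
        (n : ↥(unitaryGroupOfForm (conjLocal L (IsCMField.complexConj L) v) (cmLocalForm L 3 v))))) = 0) := by
  have hcne := IsCMField.complexConj_ne_one L
  haveI : Algebra.IsQuadraticExtension ↥(maximalRealSubfield L) L := IsCMField.isQuadraticExtension L
  letI : Invertible (2 : LocalRing L v) := (isUnit_two_localRing L v).invertible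
  obtain ⟨he1, he2, -⟩ := exp_neg_lt_one
  have hP0 : ϖ ≠ 0 := fun h => by
    rw [h, map_zero] at hϖ; exact WithZero.zero_ne_coe hϖ
  have hP1 : Valued.v ϖ < 1 := by rw [hϖ]; exact he1
  have hP2 : Valued.v (ϖ ^ 2) = WithZero.exp (-2 : ℤ) := by
    rw [map_pow, hϖ, sq, ← WithZero.exp_add]; norm_num
  -- at a tame-ramified place `|ι_v ϖ_v|_w = exp(−2) = |ϖ_w²|`: the socket's `v`-level-1 token and the 2-deep torus agree
  have hQ1 : Valued.v ((toPlace v w (HeckeCharacter.uniformizer ↥(maximalRealSubfield L) v : v.adicCompletion ↥(maximalRealSubfield L))) ^ 1) = WithZero.exp (-2 : ℤ) := by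
    rw [pow_one]; exact (valued_toPlace_uniformizer_of_ramified L (IsCMField.complexConj L) hcne w hw he).1
  have ht1 : ∀ i : Fin 3, Valued.v ((((d i : (LocalRing L v)ˣ) : LocalRing L v) w) - 1) < 1 := fun i => lt_of_le_of_lt (ht2 i) he2
  have htK := torus_three_mem_cmLocalIntegralLevel_of_deep L w hw t hd ht1
  have htred := redMat_map_torus_three_eq_one_of_deep L w t hd ht1
  have hvbT := valBound_coe_and_inv_of_mem_glInt L w hT
  -- integrality of `w`-components from `K₃`-membership
  have hvb : ∀ {Y : GL (Fin 3) (LocalRing L v)}, localGLPiEquiv L 3 v Y w ∈ glInt 3 (w.1.adicCompletion L) →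
      ValBound 1 ((Y : Matrix (Fin 3) (Fin 3) (LocalRing L v)).map (Pi.evalRingHom (fun w' : PlacesOver L v => w'.1.adicCompletion L) w)) := by
    intro Y hY i j
    have h := ((mem_glInt_iff _).1 hY).1 i j
    rw [GLn.coe_piEquiv_apply] at h
    exact (Valuation.mem_integer_iff _ _).1 h
  have htint : localGLPiEquiv L 3 v ((t : ↥(unitaryGroupOfForm (conjLocal L (IsCMField.complexConj L) v) (cmLocalForm L 3 v))) : GL (Fin 3) (LocalRing L v)) w ∈ glInt 3 (w.1.adicCompletion L) :=
    (mem_localIntegralLevel_iff_of_smul_eq (IsCMField.complexConj L) 3 _ hcne w hw _).1 htK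
  have htvb : ValBound 1 (((t : ↥(unitaryGroupOfForm (conjLocal L (IsCMField.complexConj L) v) (cmLocalForm L 3 v))) : GL (Fin 3) (LocalRing L v)).val.map (Pi.evalRingHom (fun w' : PlacesOver L v => w'.1.adicCompletion L) w)) := hvb htint
  -- `t_w = diagonal(d_w)` and its 2-deepness `(ϖ²)⁻¹(t_w − 1)` integral
  have htmat : (((t : ↥(unitaryGroupOfForm (conjLocal L (IsCMField.complexConj L) v) (cmLocalForm L 3 v))) : GL (Fin 3) (LocalRing L v)).val.map (Pi.evalRingHom (fun w' : PlacesOver L v => w'.1.adicCompletion L) w)) = Matrix.diagonal fun i => ((d i : (LocalRing L v)ˣ) : LocalRing L v) w := by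
    rw [← hd, coe_glDiagonal, Matrix.diagonal_map (RingHom.map_zero (Pi.evalRingHom (fun w' : PlacesOver L v => w'.1.adicCompletion L) w))]
    rfl
  have ht2vb : ValBound 1 ((ϖ ^ 2)⁻¹ • ((((t : ↥(unitaryGroupOfForm (conjLocal L (IsCMField.complexConj L) v) (cmLocalForm L 3 v))) : GL (Fin 3) (LocalRing L v)).val.map (Pi.evalRingHom (fun w' : PlacesOver L v => w'.1.adicCompletion L) w)) - 1)) := by
    rw [htmat]
    intro i j
    rw [Matrix.smul_apply, Matrix.sub_apply, Matrix.diagonal_apply, Matrix.one_apply, smul_eq_mul]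
    by_cases hij : i = j
    · subst hij
      rw [if_pos rfl, if_pos rfl, ← v_le_one_iff_valuation_le_one, map_mul, map_inv₀, hP2]
      calc (WithZero.exp (-2 : ℤ))⁻¹ * Valued.v ((((d i : (LocalRing L v)ˣ) : LocalRing L v) w) - 1) ≤ (WithZero.exp (-2 : ℤ))⁻¹ * WithZero.exp (-2 : ℤ) :=
            mul_le_mul' le_rfl (ht2 i)
        _ = 1 := inv_mul_cancel₀ WithZero.coe_ne_zero
    · rw [if_neg hij, if_neg hij, sub_zero, mul_zero, ← v_le_one_iff_valuation_le_one, map_zero]; exact zero_le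
  have ht1vb : ValBound 1 (((toPlace v w (HeckeCharacter.uniformizer ↥(maximalRealSubfield L) v : v.adicCompletion ↥(maximalRealSubfield L))) ^ 1)⁻¹ • ((((t : ↥(unitaryGroupOfForm (conjLocal L (IsCMField.complexConj L) v) (cmLocalForm L 3 v))) : GL (Fin 3) (LocalRing L v)).val.map (Pi.evalRingHom (fun w' : PlacesOver L v => w'.1.adicCompletion L) w)) - 1)) := by
    rw [htmat]
    intro i j
    rw [Matrix.smul_apply, Matrix.sub_apply, Matrix.diagonal_apply, Matrix.one_apply, smul_eq_mul]
    by_cases hij : i = j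
    · subst hij
      rw [if_pos rfl, if_pos rfl, ← v_le_one_iff_valuation_le_one, map_mul, map_inv₀, hQ1]
      calc (WithZero.exp (-2 : ℤ))⁻¹ * Valued.v ((((d i : (LocalRing L v)ˣ) : LocalRing L v) w) - 1) ≤ (WithZero.exp (-2 : ℤ))⁻¹ * WithZero.exp (-2 : ℤ) :=
            mul_le_mul' le_rfl (ht2 i)
        _ = 1 := inv_mul_cancel₀ WithZero.coe_ne_zero
    · rw [if_neg hij, if_neg hij, sub_zero, mul_zero, ← v_le_one_iff_valuation_le_one, map_zero]; exact zero_le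
  -- the frame point `k = ψ⁻¹(t n)`: `k ∈ K′`, `k_w = T⁻¹ X T`, `X = t_w n_w ∈ GL₃(𝒪_w)`
  have key : ∀ n : ↥(unipotentU (conjLocal L (IsCMField.complexConj L) v) (cmLocalForm L 3 v)), (n : ↥(unitaryGroupOfForm (conjLocal L (IsCMField.complexConj L) v) (cmLocalForm L 3 v))) ∈ cmLocalIntegralLevel L 3 (Matrix.of fun i j : Fin 3 => if i.val + j.val + 1 = 3 then (1 : L) else 0) v →
      ψ.symm ((t : ↥(unitaryGroupOfForm (conjLocal L (IsCMField.complexConj L) v) (cmLocalForm L 3 v))) * (n : ↥(unitaryGroupOfForm (conjLocal L (IsCMField.complexConj L) v) (cmLocalForm L 3 v)))) ∈ cmLocalIntegralLevel L 3 H' v ∧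
      ∃ X : GL (Fin 3) (w.1.adicCompletion L), X ∈ glInt 3 (w.1.adicCompletion L) ∧
        (((ψ.symm ((t : ↥(unitaryGroupOfForm (conjLocal L (IsCMField.complexConj L) v) (cmLocalForm L 3 v))) * (n : ↥(unitaryGroupOfForm (conjLocal L (IsCMField.complexConj L) v) (cmLocalForm L 3 v))))).val : GL (Fin 3) (UnitaryGroup.LocalRing L v)).val.map (Pi.evalRingHom (fun w' : PlacesOver L v => w'.1.adicCompletion L) w)) = ((T⁻¹ * X * T : GL (Fin 3) (w.1.adicCompletion L)) : Matrix (Fin 3) (Fin 3) (w.1.adicCompletion L)) ∧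
        (X : Matrix (Fin 3) (Fin 3) (w.1.adicCompletion L)) = (((t : ↥(unitaryGroupOfForm (conjLocal L (IsCMField.complexConj L) v) (cmLocalForm L 3 v))) : GL (Fin 3) (LocalRing L v)).val.map (Pi.evalRingHom (fun w' : PlacesOver L v => w'.1.adicCompletion L) w)) * (((n : ↥(unitaryGroupOfForm (conjLocal L (IsCMField.complexConj L) v) (cmLocalForm L 3 v))) : GL (Fin 3) (LocalRing L v)).val.map (Pi.evalRingHom (fun w' : PlacesOver L v => w'.1.adicCompletion L) w)) := by
    intro n hn
    have hψk : ψ (ψ.symm ((t : ↥(unitaryGroupOfForm (conjLocal L (IsCMField.complexConj L) v) (cmLocalForm L 3 v))) * (n : ↥(unitaryGroupOfForm (conjLocal L (IsCMField.complexConj L) v) (cmLocalForm L 3 v))))) = ((t : ↥(unitaryGroupOfForm (conjLocal L (IsCMField.complexConj L) v) (cmLocalForm L 3 v))) * (n : ↥(unitaryGroupOfForm (conjLocal L (IsCMField.complexConj L) v) (cmLocalForm L 3 v)))) := ψ.apply_symm_apply _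
    have hkK : ψ.symm ((t : ↥(unitaryGroupOfForm (conjLocal L (IsCMField.complexConj L) v) (cmLocalForm L 3 v))) * (n : ↥(unitaryGroupOfForm (conjLocal L (IsCMField.complexConj L) v) (cmLocalForm L 3 v)))) ∈ cmLocalIntegralLevel L 3 H' v := (hψK _).1 (by rw [hψk]; exact Subgroup.mul_mem _ htK hn)
    obtain ⟨X, hX⟩ : ∃ X : GL (Fin 3) (w.1.adicCompletion L), X = localGLPiEquiv L 3 v (((ψ (ψ.symm ((t : ↥(unitaryGroupOfForm (conjLocal L (IsCMField.complexConj L) v) (cmLocalForm L 3 v))) * (n : ↥(unitaryGroupOfForm (conjLocal L (IsCMField.complexConj L) v) (cmLocalForm L 3 v))))) : ↥(unitaryGroupOfForm (conjLocal L (IsCMField.complexConj L) v) (cmLocalForm L 3 v)))) : GL (Fin 3) (LocalRing L v)) w := ⟨_, rfl⟩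
    refine ⟨hkK, X, ?_, ?_, ?_⟩
    · rw [hX]; exact (mem_localIntegralLevel_iff_of_smul_eq (IsCMField.complexConj L) 3 _ hcne w hw _).1 ((hψK _).2 hkK)
    · have h := hψT (ψ.symm ((t : ↥(unitaryGroupOfForm (conjLocal L (IsCMField.complexConj L) v) (cmLocalForm L 3 v))) * (n : ↥(unitaryGroupOfForm (conjLocal L (IsCMField.complexConj L) v) (cmLocalForm L 3 v)))))
      rw [← hX] at h
      have hkw : localGLPiEquiv L 3 v ((ψ.symm ((t : ↥(unitaryGroupOfForm (conjLocal L (IsCMField.complexConj L) v) (cmLocalForm L 3 v))) * (n : ↥(unitaryGroupOfForm (conjLocal L (IsCMField.complexConj L) v) (cmLocalForm L 3 v))))).val : GL (Fin 3) (LocalRing L v)) w = T⁻¹ * X * T := by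
        rw [h]; group
      rw [← hkw, GLn.coe_piEquiv_apply]
    · rw [hX, hψk, GLn.coe_piEquiv_apply, Subgroup.coe_mul, Units.val_mul, Matrix.map_mul]
  -- the `v`-level-1 witness for `k`: `y k y⁻¹ = ψ⁻¹ t` with `(ψ⁻¹ t)_w = T⁻¹ t_w T ≡ 1 (ϖ_v) = (ϖ_w²)`
  have wit : ∀ n : ↥(unipotentU (conjLocal L (IsCMField.complexConj L) v) (cmLocalForm L 3 v)), ∃ y : (cmDatum L 3 H').Local v, (∀ a b, Valued.v ((((toPlace v w (HeckeCharacter.uniformizer ↥(maximalRealSubfield L) v : v.adicCompletion ↥(maximalRealSubfield L)))) ^ 1)⁻¹ *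
        ((((localNonsplitEquiv (IsCMField.complexConj L) H' (IsCMField.complexConj_ne_one L) w hw (y * ψ.symm ((t : ↥(unitaryGroupOfForm (conjLocal L (IsCMField.complexConj L) v) (cmLocalForm L 3 v))) * (n : ↥(unitaryGroupOfForm (conjLocal L (IsCMField.complexConj L) v) (cmLocalForm L 3 v)))) * y⁻¹) :
            ↥(unitaryGroupOfForm (galAdicCompletionMap (L := L) (IsCMField.complexConj L) hw) (placeForm H' w.1))) : GL (Fin 3) (w.1.adicCompletion L)) :
              Matrix (Fin 3) (Fin 3) (w.1.adicCompletion L)) a b - (1 : Matrix (Fin 3) (Fin 3) (w.1.adicCompletion L)) a b)) ≤ 1) := by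
    intro n
    obtain ⟨u, hu⟩ := exists_torusConj_mul_inv_eq L t hd ha' hb' n
    have htn : ((t : ↥(unitaryGroupOfForm (conjLocal L (IsCMField.complexConj L) v) (cmLocalForm L 3 v))) * (n : ↥(unitaryGroupOfForm (conjLocal L (IsCMField.complexConj L) v) (cmLocalForm L 3 v)))) = (u : ↥(unitaryGroupOfForm (conjLocal L (IsCMField.complexConj L) v) (cmLocalForm L 3 v))) * (t : ↥(unitaryGroupOfForm (conjLocal L (IsCMField.complexConj L) v) (cmLocalForm L 3 v))) * (u : ↥(unitaryGroupOfForm (conjLocal L (IsCMField.complexConj L) v) (cmLocalForm L 3 v)))⁻¹ := by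
      rw [HeisRing.coe_mul_torus_mul_inv (conjLocal L (IsCMField.complexConj L) v) t u, hu]
    refine ⟨ψ.symm ((u : ↥(unitaryGroupOfForm (conjLocal L (IsCMField.complexConj L) v) (cmLocalForm L 3 v)))⁻¹), fun a b => ?_⟩
    have hyky : ψ.symm ((u : ↥(unitaryGroupOfForm (conjLocal L (IsCMField.complexConj L) v) (cmLocalForm L 3 v)))⁻¹) * ψ.symm ((t : ↥(unitaryGroupOfForm (conjLocal L (IsCMField.complexConj L) v) (cmLocalForm L 3 v))) * (n : ↥(unitaryGroupOfForm (conjLocal L (IsCMField.complexConj L) v) (cmLocalForm L 3 v)))) * (ψ.symm ((u : ↥(unitaryGroupOfForm (conjLocal L (IsCMField.complexConj L) v) (cmLocalForm L 3 v)))⁻¹))⁻¹ = ψ.symm (t : ↥(unitaryGroupOfForm (conjLocal L (IsCMField.complexConj L) v) (cmLocalForm L 3 v))) := by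
      apply ψ.injective
      simp only [map_mul, map_inv, ψ.apply_symm_apply]
      rw [htn]; group
    have h := hψT (ψ.symm (t : ↥(unitaryGroupOfForm (conjLocal L (IsCMField.complexConj L) v) (cmLocalForm L 3 v))))
    rw [ψ.apply_symm_apply] at h
    have hγw : localGLPiEquiv L 3 v ((ψ.symm (t : ↥(unitaryGroupOfForm (conjLocal L (IsCMField.complexConj L) v) (cmLocalForm L 3 v)))).val : GL (Fin 3) (LocalRing L v)) w =
        T⁻¹ * localGLPiEquiv L 3 v ((t : ↥(unitaryGroupOfForm (conjLocal L (IsCMField.complexConj L) v) (cmLocalForm L 3 v))) : GL (Fin 3) (LocalRing L v)) w * T := by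
      rw [h]; group
    have hγmat : (((ψ.symm (t : ↥(unitaryGroupOfForm (conjLocal L (IsCMField.complexConj L) v) (cmLocalForm L 3 v)))).val : GL (Fin 3) (UnitaryGroup.LocalRing L v)).val.map (Pi.evalRingHom (fun w' : PlacesOver L v => w'.1.adicCompletion L) w)) =
        ((T⁻¹ : GL (Fin 3) (w.1.adicCompletion L)) : Matrix (Fin 3) (Fin 3) (w.1.adicCompletion L)) * (((t : ↥(unitaryGroupOfForm (conjLocal L (IsCMField.complexConj L) v) (cmLocalForm L 3 v))) : GL (Fin 3) (LocalRing L v)).val.map (Pi.evalRingHom (fun w' : PlacesOver L v => w'.1.adicCompletion L) w)) * (T : Matrix (Fin 3) (Fin 3) (w.1.adicCompletion L)) := by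
      rw [← GLn.coe_piEquiv_apply, hγw, Units.val_mul, Units.val_mul, GLn.coe_piEquiv_apply]
    have hM : ValBound 1 (((T⁻¹ : GL (Fin 3) (w.1.adicCompletion L)) : Matrix (Fin 3) (Fin 3) (w.1.adicCompletion L)) * (((toPlace v w (HeckeCharacter.uniformizer ↥(maximalRealSubfield L) v : v.adicCompletion ↥(maximalRealSubfield L))) ^ 1)⁻¹ • ((((t : ↥(unitaryGroupOfForm (conjLocal L (IsCMField.complexConj L) v) (cmLocalForm L 3 v))) : GL (Fin 3) (LocalRing L v)).val.map (Pi.evalRingHom (fun w' : PlacesOver L v => w'.1.adicCompletion L) w)) - 1)) * (T : Matrix (Fin 3) (Fin 3) (w.1.adicCompletion L))) := by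
      have h1 := hvbT.2.mul ht1vb; rw [one_mul] at h1
      have h2 := h1.mul hvbT.1; rw [one_mul] at h2
      exact h2
    have e := congrFun (congrFun (inv_smul_coe_inv_mul_mul_coe_sub_one L w (((toPlace v w (HeckeCharacter.uniformizer ↥(maximalRealSubfield L) v : v.adicCompletion ↥(maximalRealSubfield L))) ^ 1)⁻¹) T (((t : ↥(unitaryGroupOfForm (conjLocal L (IsCMField.complexConj L) v) (cmLocalForm L 3 v))) : GL (Fin 3) (LocalRing L v)).val.map (Pi.evalRingHom (fun w' : PlacesOver L v => w'.1.adicCompletion L) w))) a) b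
    rw [Matrix.smul_apply, Matrix.sub_apply, smul_eq_mul] at e
    rw [hyky, coe_coe_localNonsplitEquiv_apply, hγmat, e]
    exact (v_le_one_iff_valuation_le_one _).2 (hM a b)
  -- residual nilpotency of `n_w` on `N` (★ FILE A)
  have hn3 : ∀ n : ↥(unipotentU (conjLocal L (IsCMField.complexConj L) v) (cmLocalForm L 3 v)), (redMat (((n : ↥(unitaryGroupOfForm (conjLocal L (IsCMField.complexConj L) v) (cmLocalForm L 3 v))) : GL (Fin 3) (LocalRing L v)).val.map (Pi.evalRingHom (fun w' : PlacesOver L v => w'.1.adicCompletion L) w)) - 1) ^ 3 = 0 := fun n => by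
    rw [← HeisRing.heisElt_heisX_heisY (conjLocal L (IsCMField.complexConj L) v) (conjLocal_conjLocal_cm L v) (cmLocalForm_eq_over L 3 v) n]
    exact redMat_map_heisElt_sub_one_pow_three L v w hw _ _
  -- BOUNDARY strata: residual type transported through `T⁻¹(t_w n_w)T`
  have bd : ∀ n : ↥(unipotentU (conjLocal L (IsCMField.complexConj L) v) (cmLocalForm L 3 v)), (n : ↥(unitaryGroupOfForm (conjLocal L (IsCMField.complexConj L) v) (cmLocalForm L 3 v))) ∈ cmLocalIntegralLevel L 3 (Matrix.of fun i j : Fin 3 => if i.val + j.val + 1 = 3 then (1 : L) else 0) v → ∀ r : ℕ, (redMat (((n : ↥(unitaryGroupOfForm (conjLocal L (IsCMField.complexConj L) v) (cmLocalForm L 3 v))) : GL (Fin 3) (LocalRing L v)).val.map (Pi.evalRingHom (fun w' : PlacesOver L v => w'.1.adicCompletion L) w)) - 1).rank = r →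
      ψ.symm ((t : ↥(unitaryGroupOfForm (conjLocal L (IsCMField.complexConj L) v) (cmLocalForm L 3 v))) * (n : ↥(unitaryGroupOfForm (conjLocal L (IsCMField.complexConj L) v) (cmLocalForm L 3 v)))) ∈ cmLocalIntegralLevel L 3 H' v ∧ (redMat (((ψ.symm ((t : ↥(unitaryGroupOfForm (conjLocal L (IsCMField.complexConj L) v) (cmLocalForm L 3 v))) * (n : ↥(unitaryGroupOfForm (conjLocal L (IsCMField.complexConj L) v) (cmLocalForm L 3 v))))).val : GL (Fin 3) (UnitaryGroup.LocalRing L v)).val.map (Pi.evalRingHom (fun w' : PlacesOver L v => w'.1.adicCompletion L) w)) - 1) ^ 3 = 0 ∧ (redMat (((ψ.symm ((t : ↥(unitaryGroupOfForm (conjLocal L (IsCMField.complexConj L) v) (cmLocalForm L 3 v))) * (n : ↥(unitaryGroupOfForm (conjLocal L (IsCMField.complexConj L) v) (cmLocalForm L 3 v))))).val : GL (Fin 3) (UnitaryGroup.LocalRing L v)).val.map (Pi.evalRingHom (fun w' : PlacesOver L v => w'.1.adicCompletion L) w)) - 1).rank = r := by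
    intro n hn r hr
    obtain ⟨hkK, X, hXint, hkmat, hXmat⟩ := key n hn
    have hnint : localGLPiEquiv L 3 v ((n : ↥(unitaryGroupOfForm (conjLocal L (IsCMField.complexConj L) v) (cmLocalForm L 3 v))) : GL (Fin 3) (LocalRing L v)) w ∈ glInt 3 (w.1.adicCompletion L) :=
      (mem_localIntegralLevel_iff_of_smul_eq (IsCMField.complexConj L) 3 _ hcne w hw _).1 hn
    have hXred : redMat (X : Matrix (Fin 3) (Fin 3) (w.1.adicCompletion L)) = redMat (((n : ↥(unitaryGroupOfForm (conjLocal L (IsCMField.complexConj L) v) (cmLocalForm L 3 v))) : GL (Fin 3) (LocalRing L v)).val.map (Pi.evalRingHom (fun w' : PlacesOver L v => w'.1.adicCompletion L) w)) := by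
      rw [hXmat]; exact redMat_mul_of_redMat_eq_one htvb (hvb hnint) htred
    refine ⟨hkK, ?_, ?_⟩
    · rw [hkmat, redMat_conj_sub_one_pow_eq_zero_iff hT hXint 3, hXred]; exact hn3 n
    · rw [hkmat, rank_redMat_conj_sub_one_eq hT hXint, hXred]; exact hr
  -- INTERIOR strata: the level-two matrix transported
  have int : ∀ n : ↥(unipotentU (conjLocal L (IsCMField.complexConj L) v) (cmLocalForm L 3 v)), (n : ↥(unitaryGroupOfForm (conjLocal L (IsCMField.complexConj L) v) (cmLocalForm L 3 v))) ∈ cmLocalIntegralLevel L 3 (Matrix.of fun i j : Fin 3 => if i.val + j.val + 1 = 3 then (1 : L) else 0) v → (redMat (((n : ↥(unitaryGroupOfForm (conjLocal L (IsCMField.complexConj L) v) (cmLocalForm L 3 v))) : GL (Fin 3) (LocalRing L v)).val.map (Pi.evalRingHom (fun w' : PlacesOver L v => w'.1.adicCompletion L) w)) - 1).rank = 0 → ∀ s : ℕ,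
      (redMat (ϖ⁻¹ • ((((n : ↥(unitaryGroupOfForm (conjLocal L (IsCMField.complexConj L) v) (cmLocalForm L 3 v))) : GL (Fin 3) (LocalRing L v)).val.map (Pi.evalRingHom (fun w' : PlacesOver L v => w'.1.adicCompletion L) w)) - 1))).rank = s →
      ψ.symm ((t : ↥(unitaryGroupOfForm (conjLocal L (IsCMField.complexConj L) v) (cmLocalForm L 3 v))) * (n : ↥(unitaryGroupOfForm (conjLocal L (IsCMField.complexConj L) v) (cmLocalForm L 3 v)))) ∈ cmLocalIntegralLevel L 3 H' v ∧
      (∀ a b, Valued.v (ϖ⁻¹ * ((((ψ.symm ((t : ↥(unitaryGroupOfForm (conjLocal L (IsCMField.complexConj L) v) (cmLocalForm L 3 v))) * (n : ↥(unitaryGroupOfForm (conjLocal L (IsCMField.complexConj L) v) (cmLocalForm L 3 v))))).val : GL (Fin 3) (UnitaryGroup.LocalRing L v)).val.map (Pi.evalRingHom (fun w' : PlacesOver L v => w'.1.adicCompletion L) w)) a b - (1 : Matrix (Fin 3) (Fin 3) (w.1.adicCompletion L)) a b)) ≤ 1) ∧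
      (redMat (ϖ⁻¹ • ((((ψ.symm ((t : ↥(unitaryGroupOfForm (conjLocal L (IsCMField.complexConj L) v) (cmLocalForm L 3 v))) * (n : ↥(unitaryGroupOfForm (conjLocal L (IsCMField.complexConj L) v) (cmLocalForm L 3 v))))).val : GL (Fin 3) (UnitaryGroup.LocalRing L v)).val.map (Pi.evalRingHom (fun w' : PlacesOver L v => w'.1.adicCompletion L) w)) - 1))) ^ 3 = 0 ∧ (redMat (ϖ⁻¹ • ((((ψ.symm ((t : ↥(unitaryGroupOfForm (conjLocal L (IsCMField.complexConj L) v) (cmLocalForm L 3 v))) * (n : ↥(unitaryGroupOfForm (conjLocal L (IsCMField.complexConj L) v) (cmLocalForm L 3 v))))).val : GL (Fin 3) (UnitaryGroup.LocalRing L v)).val.map (Pi.evalRingHom (fun w' : PlacesOver L v => w'.1.adicCompletion L) w)) - 1))).rank = s ∧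
      redMat (ϖ⁻¹ • ((((ψ.symm ((t : ↥(unitaryGroupOfForm (conjLocal L (IsCMField.complexConj L) v) (cmLocalForm L 3 v))) * (n : ↥(unitaryGroupOfForm (conjLocal L (IsCMField.complexConj L) v) (cmLocalForm L 3 v))))).val : GL (Fin 3) (UnitaryGroup.LocalRing L v)).val.map (Pi.evalRingHom (fun w' : PlacesOver L v => w'.1.adicCompletion L) w)) - 1)) = redMat ((T⁻¹ : GL (Fin 3) (w.1.adicCompletion L)) : Matrix (Fin 3) (Fin 3) (w.1.adicCompletion L)) * redMat (ϖ⁻¹ • ((((n : ↥(unitaryGroupOfForm (conjLocal L (IsCMField.complexConj L) v) (cmLocalForm L 3 v))) : GL (Fin 3) (LocalRing L v)).val.map (Pi.evalRingHom (fun w' : PlacesOver L v => w'.1.adicCompletion L) w)) - 1)) * redMat (T : Matrix (Fin 3) (Fin 3) (w.1.adicCompletion L)) := by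
    intro n hn h0 s hs
    obtain ⟨hkK, X, hXint, hkmat, hXmat⟩ := key n hn
    obtain ⟨hnvb, hn1vb, hn3'⟩ := valBound_smul_map_sub_one_of_rank_eq_zero_of_valued_eq L w hw hϖ h2w n hn h0
    obtain ⟨hM1, hMred⟩ := redMat_inv_smul_mul_sub_one_of_two_deep L w hP0 hP1 ht2vb hnvb hn1vb
    have hMc : ValBound 1 (((T⁻¹ : GL (Fin 3) (w.1.adicCompletion L)) : Matrix (Fin 3) (Fin 3) (w.1.adicCompletion L)) * (ϖ⁻¹ • ((((t : ↥(unitaryGroupOfForm (conjLocal L (IsCMField.complexConj L) v) (cmLocalForm L 3 v))) : GL (Fin 3) (LocalRing L v)).val.map (Pi.evalRingHom (fun w' : PlacesOver L v => w'.1.adicCompletion L) w)) * (((n : ↥(unitaryGroupOfForm (conjLocal L (IsCMField.complexConj L) v) (cmLocalForm L 3 v))) : GL (Fin 3) (LocalRing L v)).val.map (Pi.evalRingHom (fun w' : PlacesOver L v => w'.1.adicCompletion L) w)) - 1)) * (T : Matrix (Fin 3) (Fin 3) (w.1.adicCompletion L))) := by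
      have h1 := hvbT.2.mul hM1; rw [one_mul] at h1
      have h2 := h1.mul hvbT.1; rw [one_mul] at h2
      exact h2
    have hk2 : ϖ⁻¹ • ((((ψ.symm ((t : ↥(unitaryGroupOfForm (conjLocal L (IsCMField.complexConj L) v) (cmLocalForm L 3 v))) * (n : ↥(unitaryGroupOfForm (conjLocal L (IsCMField.complexConj L) v) (cmLocalForm L 3 v))))).val : GL (Fin 3) (UnitaryGroup.LocalRing L v)).val.map (Pi.evalRingHom (fun w' : PlacesOver L v => w'.1.adicCompletion L) w)) - 1) =
        ((T⁻¹ : GL (Fin 3) (w.1.adicCompletion L)) : Matrix (Fin 3) (Fin 3) (w.1.adicCompletion L)) * (ϖ⁻¹ • ((((t : ↥(unitaryGroupOfForm (conjLocal L (IsCMField.complexConj L) v) (cmLocalForm L 3 v))) : GL (Fin 3) (LocalRing L v)).val.map (Pi.evalRingHom (fun w' : PlacesOver L v => w'.1.adicCompletion L) w)) * (((n : ↥(unitaryGroupOfForm (conjLocal L (IsCMField.complexConj L) v) (cmLocalForm L 3 v))) : GL (Fin 3) (LocalRing L v)).val.map (Pi.evalRingHom (fun w' : PlacesOver L v => w'.1.adicCompletion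 L) w)) - 1)) * (T : Matrix (Fin 3) (Fin 3) (w.1.adicCompletion L)) := by
      rw [hkmat, Units.val_mul, Units.val_mul, inv_smul_coe_inv_mul_mul_coe_sub_one, hXmat]
    obtain ⟨hrank, hnil⟩ := rank_redMat_coe_inv_mul_mul_coe L w hT hM1
    refine ⟨hkK, fun a b => ?_, ?_, ?_, ?_⟩
    · have e := congrFun (congrFun hk2 a) b
      rw [Matrix.smul_apply, Matrix.sub_apply, smul_eq_mul] at e
      rw [e]
      exact (v_le_one_iff_valuation_le_one _).2 (hMc a b)
    · rw [hk2, hnil, hMred]; exact hn3'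
    · rw [hk2, hrank, hMred]; exact hs
    · rw [hk2, redMat_coe_inv_mul_mul_coe L w hT hM1, hMred]
  refine ⟨fun n hn hr => ?_, fun n hn h0 hs => ?_, fun n hn h0 hs => ?_, fun n hn h0 hs => ?_, fun n hn => ?_⟩
  · obtain ⟨hkK, hk3, hkr⟩ := bd n hn 2 hr
    obtain ⟨y, hy⟩ := wit n
    exact hc _ ⟨hkK, hk3, hkr, y, hy⟩
  · obtain ⟨hkK, hl1, hk3, hkr, -⟩ := int n hn h0 2 hs
    exact hc'.2 _ ⟨hkK, hl1, hk3, hkr⟩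
  · exact int n hn h0 1 hs
  · obtain ⟨hkK, hl1, hk3, hkr, -⟩ := int n hn h0 0 hs
    exact hc'.1 _ ⟨hkK, hl1, hk3, hkr⟩
  · have hψk : ψ (ψ.symm ((t : ↥(unitaryGroupOfForm (conjLocal L (IsCMField.complexConj L) v) (cmLocalForm L 3 v))) * (n : ↥(unitaryGroupOfForm (conjLocal L (IsCMField.complexConj L) v) (cmLocalForm L 3 v))))) = ((t : ↥(unitaryGroupOfForm (conjLocal L (IsCMField.complexConj L) v) (cmLocalForm L 3 v))) * (n : ↥(unitaryGroupOfForm (conjLocal L (IsCMField.complexConj L) v) (cmLocalForm L 3 v)))) := ψ.apply_symm_apply _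
    have hkK : ψ.symm ((t : ↥(unitaryGroupOfForm (conjLocal L (IsCMField.complexConj L) v) (cmLocalForm L 3 v))) * (n : ↥(unitaryGroupOfForm (conjLocal L (IsCMField.complexConj L) v) (cmLocalForm L 3 v)))) ∉ cmLocalIntegralLevel L 3 H' v := fun h => hn (by
      have h' := (hψK _).2 h
      rw [hψk] at h'
      exact (Subgroup.mul_mem_cancel_left _ htK).1 h')
    exact image_eq_zero_of_notMem_tsupport fun h => hkK (hgK h)

end Literature.NumberTheory.Automorphic.UnitaryGroup

end
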